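import Summits.ValiantsHypothesis.ValiantsHypothesis.Theorems.DepthWindowHomRel
import Mathlib.Data.List.GetD
import HarnessLib

/-!
# The block-lemma scale is not degenerate: `¬ HomRel k 0` for `k ≥ 1` (route `DepthWindow`)

First NEGATIVE rung on the `HomRel` ladder of `Theorems/DepthWindowHomRel.lean` (crux item
`HomSubReach`): a gate list of relative product-depth `0` (no product gates) computes only
polynomials of total degree `≤ 1`, so it cannot output the degree-`2` component `y²` of the
depth-`1` block `[y · y]`; hence `HomRel 1 0` fails, and by monotonicity so does `HomRel k 0` for
every `k ≥ 1`.  Together with `homRel_zero_zero : HomRel 0 0` and the slope-one theorem for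
bounded fan-in (`exists_hom_block_of_fanIn`) this brackets the scale: the conclusion of `HomRel`
has teeth (it is not satisfiable by bookkeeping), and the open entries `HomRel 2 2 / 3 4 / 5 7`
are genuine statements.  A sanity rung only — nothing here bears on `VP ≠ VNP`.

[cite: Burgisser2000, Def. 2.1] [cite: LimayeSrinivasanTavenas2025, Lemma 19] [cite: NisanWigderson1996, Thm. 1]
-/

set_option linter.dupNamespace false

namespace Summit.ValiantsHypothesis.ValiantsHypothesis.Theorems.DepthWindow

open MvPolynomial Literature.Computability.AlgebraicComplexity ArithCircuit

/-- A list sum of polynomials of total degree `≤ 1` has total degree `≤ 1`. -/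
theorem totalDegree_list_sum_le_one {τ : Type} :
    ∀ L : List (MvPolynomial τ ℂ), (∀ p ∈ L, p.totalDegree ≤ 1) → L.sum.totalDegree ≤ 1
  | [], _ => by simp
  | p :: L, h => by
      rw [List.sum_cons]
      exact (totalDegree_add _ _).trans
        (max_le (h p (by simp)) (totalDegree_list_sum_le_one L fun q hq => h q (by simp [hq])))

/-- **No product gates ⇒ affine values.**  If every `prodWeight`-depth entry of a gate list is
`≤ 0`, every gate value has total degree `≤ 1`. [cite: Burgisser2000, Def. 2.1] -/
theorem totalDegree_le_one_of_depth_zero {τ : Type} :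
    ∀ (Ψ : List (Gate ℂ τ)), (∀ n ∈ gateWDepths prodWeight Ψ, n ≤ 0) →
      ∀ v ∈ gateValues Ψ, v.totalDegree ≤ 1 := by
  intro Ψ
  induction Ψ using List.reverseRecOn with
  | nil => intro _ v hv; exact absurd hv (by simp [gateValues])
  | append_singleton Ψ G ih =>
      intro hdep v hv
      rw [gateWDepths_append_singleton] at hdep
      have hpre : ∀ n ∈ gateWDepths prodWeight Ψ, n ≤ 0 :=
        fun n hn => hdep n (List.mem_append_left _ hn)
      rw [gateValues_append_singleton, List.mem_append, List.mem_singleton] at hv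
      rcases hv with hv | rfl
      · exact ih hpre v hv
      · have hG := hdep _ (List.mem_append_right _ (List.mem_singleton_self _))
        -- every operand over `gateValues Ψ` has total degree `≤ 1`
        have hop : ∀ u : Operand ℂ τ, (u.eval (gateValues Ψ)).totalDegree ≤ 1 := by
          intro u
          cases u with
          | var t => simp [Operand.eval, totalDegree_X]
          | const c => simp [Operand.eval, totalDegree_C]
          | gate j =>
              show ((gateValues Ψ).getD j 0).totalDegree ≤ 1
              by_cases hj : j < (gateValues Ψ).length
              · rw [List.getD_eq_getElem _ _ hj]; exact ih hpre _ (List.getElem_mem hj)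
              · rw [List.getD_eq_default _ _ (by omega)]; simp
        cases G with
        | prod us =>
            -- a product gate has depth entry `≥ 1`
            exfalso
            simp [prodWeight, Gate.isProd] at hG
        | sum args =>
            show ((args.map fun a : ℂ × Operand ℂ τ => a.1 • a.2.eval (gateValues Ψ)).sum).totalDegree ≤ 1
            refine totalDegree_list_sum_le_one _ fun p hp => ?_
            obtain ⟨a, -, rfl⟩ := List.mem_map.mp hp
            exact (totalDegree_smul_le _ _).trans (hop a.2)

/-- **`HomRel 1 0` is false.**  Witness: `τ = Unit`, `w = 1`, `d = 2`, the one-gate block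
`[y · y]` (relative product-depth `1`); a depth-`0` list has affine values, so no operand over it
evaluates to the degree-`2` component `y²`. [cite: LimayeSrinivasanTavenas2025, Lemma 19] -/
theorem not_homRel_one_zero : ¬ HomRel 1 0 := by
  rintro ⟨a, ha⟩
  have hΦ : ∀ n ∈ gateWDepths prodWeight
      ([Gate.prod [Operand.var (), Operand.var ()]] : List (Gate ℂ Unit)), n ≤ 1 := by
    intro n hn
    have h1 : gateWDepths prodWeight
        ([Gate.prod [Operand.var (), Operand.var ()]] : List (Gate ℂ Unit)) = [1] := by
      rw [show ([Gate.prod [Operand.var (), Operand.var ()]] : List (Gate ℂ Unit)) =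
        ([] : List (Gate ℂ Unit)) ++ [Gate.prod [Operand.var (), Operand.var ()]] from rfl,
        gateWDepths_append_singleton]
      simp [gateWDepths, prodWeight, Gate.isProd, Gate.args, Operand.depthIn]
    rw [h1] at hn
    simp only [List.mem_singleton] at hn
    omega
  obtain ⟨Ψ, out, -, hdepth, -, hout⟩ :=
    ha Unit (fun _ => 1) (fun _ => le_rfl) 2
      ([Gate.prod [Operand.var (), Operand.var ()]] : List (Gate ℂ Unit)) hΦ
  obtain ⟨-, hev⟩ := hout 0 2 (by simp) le_rfl
  -- the target component is `y²`
  have hval : (gateValues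
      ([Gate.prod [Operand.var (), Operand.var ()]] : List (Gate ℂ Unit))).getD 0 0 = X () * X () := by
    rw [show ([Gate.prod [Operand.var (), Operand.var ()]] : List (Gate ℂ Unit)) =
      ([] : List (Gate ℂ Unit)) ++ [Gate.prod [Operand.var (), Operand.var ()]] from rfl,
      gateValues_append_singleton]
    simp [gateValues, Gate.eval, Operand.eval]
  have hhom : (X () * X () : MvPolynomial Unit ℂ).IsHomogeneous 2 :=
    (isHomogeneous_X ℂ ()).mul (isHomogeneous_X ℂ ())
  have hcomp : weightedHomogeneousComponent (fun _ : Unit => 1) 2 (X () * X () : MvPolynomial Unit ℂ)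
      = X () * X () := hhom.weightedHomogeneousComponent_same
  rw [hval, hcomp] at hev
  -- but every operand over a depth-`0` list has total degree `≤ 1`
  have hdeg : ((out 0 2).eval (gateValues Ψ)).totalDegree ≤ 1 := by
    cases out 0 2 with
    | var t => simp [Operand.eval, totalDegree_X]
    | const c => simp [Operand.eval, totalDegree_C]
    | gate j =>
        show ((gateValues Ψ).getD j 0).totalDegree ≤ 1
        by_cases hj : j < (gateValues Ψ).length
        · rw [List.getD_eq_getElem _ _ hj]
          exact totalDegree_le_one_of_depth_zero Ψ hdepth _ (List.getElem_mem hj)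
        · rw [List.getD_eq_default _ _ (by omega)]; simp
  rw [hev, show (X () * X () : MvPolynomial Unit ℂ) = X () ^ 2 from (sq _).symm,
    totalDegree_X_pow] at hdeg
  omega

/-- **`HomRel k 0` is false for every `k ≥ 1`** (monotonicity in the block depth).
[cite: LimayeSrinivasanTavenas2025, Lemma 19] -/
theorem not_homRel_succ_zero (k : ℕ) : ¬ HomRel (k + 1) 0 :=
  fun h => not_homRel_one_zero (HomRel.of_le_left (Nat.le_add_left 1 k) h)

end Summit.ValiantsHypothesis.ValiantsHypothesis.Theorems.DepthWindow
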